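import Literature.NumberTheory.Transcendental.SigmaJets
import HarnessLib

/-!
# Quasi-periodicity of the Weierstrass sigma function under the whole lattice

Topic: `Literature/NumberTheory/Transcendental`. A classical closed formula needed by Baker's
method on the groups `M_κ` (plan item W4(e) of the unit
`provefact-Literature.NumberTheory.Transcendental.H-b596640137`: LOWER bounds for the theta
functions at the points `s·v`, whose `E`-coordinates run through lattice translates of finitely
many torsion representatives): for every lattice vector `λ = mω₁ + nω₂` with quasi-period
`η(λ) = mη₁ + nη₂`,

`σ(z + λ) = (-1)^{m+n+mn} · e^{η(λ)(z + λ/2)} · σ(z)`      (`PeriodPair.weierstrassSigma_add_lattice`)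

(Whittaker–Watson §20.421, the general case of `σ(z + 2ω) = -e^{2η(z+ω)}σ(z)`; the sign
`(-1)^{m+n+mn}` is `+1` exactly when `λ ∈ 2Λ`). It is obtained from the two generator cases
(`WeierstrassSigma.lean`, discharged in `WeierstrassSigmaProofs.lean`) by induction over `ℤ²`; the
compatibility of the two inductions is **Legendre's relation** `η₁ω₂ - η₂ω₁ = ±2πi`
(`WeierstrassZetaLegendre.lean`), in the form `e^{n(η₂ω₁ - η₁ω₂)/2} = (-1)^n`
(`PeriodPair.cexp_int_mul_half_legendre`). As a consequence the modulus of the automorphy factor is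
the explicit `e^{Re(η(λ)(z + λ/2))}`, which is what growth and lower-bound estimates use
(`PeriodPair.norm_weierstrassSigma_add_lattice`). Everything here is proved.

## References

* E. T. Whittaker, G. N. Watson, *A Course of Modern Analysis*, §20.421, §20.411 (Legendre).
* A. Baker, G. Wüstholz, *Logarithmic Forms and Diophantine Geometry*, CUP 2007, §6.8 (p. 119:
  `log max |f_i(sv)| ≫ -(s² + 1)‖v‖²`).
-/

noncomputable section

open Complex

namespace Literature.NumberTheory.Transcendental

variable (L : PeriodPair)

/-- **Legendre's relation, exponentiated**: `e^{n(η₂ω₁ - η₁ω₂)/2} = (-1)^n` for every integer `n`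
(`η₁ω₂ - η₂ω₁ = ±2πi`, either sign). [cite: WhittakerWatson1927, §20.411] -/
theorem _root_.PeriodPair.cexp_int_mul_half_legendre (n : ℤ) :
    cexp (n * ((L.η₂ * L.ω₁ - L.η₁ * L.ω₂) / 2)) = (-1 : ℂ) ^ n := by
  rcases L.legendre_relation_up_to_sign with h | h
  · have e : (L.η₂ * L.ω₁ - L.η₁ * L.ω₂) / 2 = -(Real.pi * I) := by
      linear_combination (-(1 : ℂ) / 2) * h
    rw [e, Complex.exp_int_mul, Complex.exp_neg, Complex.exp_pi_mul_I, inv_neg, inv_one]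
  · have e : (L.η₂ * L.ω₁ - L.η₁ * L.ω₂) / 2 = Real.pi * I := by
      linear_combination ((1 : ℂ) / 2) * h
    rw [e, Complex.exp_int_mul, Complex.exp_pi_mul_I]

/-- The **automorphy factor of `σ` under `λ = mω₁ + nω₂`**:
`(-1)^{m+n+mn} e^{(mη₁ + nη₂)(z + (mω₁ + nω₂)/2)}`. [cite: WhittakerWatson1927, §20.421] -/
def _root_.PeriodPair.sigmaLatticeAut (m n : ℤ) (z : ℂ) : ℂ :=
  (-1 : ℂ) ^ (m + n + m * n) *
    cexp ((m * L.η₁ + n * L.η₂) * (z + (m * L.ω₁ + n * L.ω₂) / 2))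

/-- The automorphy factor never vanishes. [folklore] -/
theorem _root_.PeriodPair.sigmaLatticeAut_ne_zero (m n : ℤ) (z : ℂ) : L.sigmaLatticeAut m n z ≠ 0 :=
  mul_ne_zero (zpow_ne_zero _ (by norm_num)) (Complex.exp_ne_zero _)

/-- `λ = 0`: the factor is `1`. [folklore] -/
@[simp] theorem _root_.PeriodPair.sigmaLatticeAut_zero_zero (z : ℂ) : L.sigmaLatticeAut 0 0 z = 1 := by
  simp [PeriodPair.sigmaLatticeAut]

/-- Step in `m`: `aut(m+1, n; z) = -e^{η₁(z + λ + ω₁/2)} · aut(m, n; z)` (Legendre). [folklore] -/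
theorem _root_.PeriodPair.sigmaLatticeAut_succ_left (m n : ℤ) (z : ℂ) :
    L.sigmaLatticeAut (m + 1) n z =
      -cexp (L.η₁ * (z + (m * L.ω₁ + n * L.ω₂) + L.ω₁ / 2)) * L.sigmaLatticeAut m n z := by
  have hL := L.cexp_int_mul_half_legendre n
  unfold PeriodPair.sigmaLatticeAut
  have h1 : (-1 : ℂ) ^ (m + 1 + n + (m + 1) * n) = (-1 : ℂ) ^ (m + n + m * n) * (-1) ^ (1 + n) := by
    rw [← zpow_add₀ (by norm_num : (-1 : ℂ) ≠ 0)]; ring_nf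
  have h2 : cexp (((m + 1 : ℤ) * L.η₁ + n * L.η₂) * (z + ((m + 1 : ℤ) * L.ω₁ + n * L.ω₂) / 2)) =
      cexp ((m * L.η₁ + n * L.η₂) * (z + (m * L.ω₁ + n * L.ω₂) / 2)) *
        cexp (L.η₁ * (z + (m * L.ω₁ + n * L.ω₂) + L.ω₁ / 2)) *
          cexp (n * ((L.η₂ * L.ω₁ - L.η₁ * L.ω₂) / 2)) := by
    rw [← Complex.exp_add, ← Complex.exp_add]
    congr 1
    push_cast
    ring
  have h3 : (-1 : ℂ) ^ (1 + n) = -(-1 : ℂ) ^ n := by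
    rw [zpow_add₀ (by norm_num : (-1 : ℂ) ≠ 0), zpow_one]; ring
  rw [h1, h2, hL, h3]
  have h4 : (-1 : ℂ) ^ n * (-1 : ℂ) ^ n = 1 := by
    rw [← zpow_add₀ (by norm_num : (-1 : ℂ) ≠ 0), ← two_mul, zpow_mul]
    norm_num
  linear_combination
    (-(-1 : ℂ) ^ (m + n + m * n) * cexp ((m * L.η₁ + n * L.η₂) * (z + (m * L.ω₁ + n * L.ω₂) / 2)) *
      cexp (L.η₁ * (z + (m * L.ω₁ + n * L.ω₂) + L.ω₁ / 2))) * h4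

/-- Step in `n`: `aut(m, n+1; z) = -e^{η₂(z + λ + ω₂/2)} · aut(m, n; z)` (Legendre). [folklore] -/
theorem _root_.PeriodPair.sigmaLatticeAut_succ_right (m n : ℤ) (z : ℂ) :
    L.sigmaLatticeAut m (n + 1) z =
      -cexp (L.η₂ * (z + (m * L.ω₁ + n * L.ω₂) + L.ω₂ / 2)) * L.sigmaLatticeAut m n z := by
  have hL := L.cexp_int_mul_half_legendre (-m)
  unfold PeriodPair.sigmaLatticeAut
  have h1 : (-1 : ℂ) ^ (m + (n + 1) + m * (n + 1)) = (-1 : ℂ) ^ (m + n + m * n) * (-1) ^ (1 + m) := by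
    rw [← zpow_add₀ (by norm_num : (-1 : ℂ) ≠ 0)]; ring_nf
  have h2 : cexp ((m * L.η₁ + (n + 1 : ℤ) * L.η₂) * (z + (m * L.ω₁ + (n + 1 : ℤ) * L.ω₂) / 2)) =
      cexp ((m * L.η₁ + n * L.η₂) * (z + (m * L.ω₁ + n * L.ω₂) / 2)) *
        cexp (L.η₂ * (z + (m * L.ω₁ + n * L.ω₂) + L.ω₂ / 2)) *
          cexp ((-m : ℤ) * ((L.η₂ * L.ω₁ - L.η₁ * L.ω₂) / 2)) := by
    rw [← Complex.exp_add, ← Complex.exp_add]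
    congr 1
    push_cast
    ring
  have h3 : (-1 : ℂ) ^ (1 + m) = -(-1 : ℂ) ^ m := by
    rw [zpow_add₀ (by norm_num : (-1 : ℂ) ≠ 0), zpow_one]; ring
  rw [h1, h2, hL, h3]
  have h4 : (-1 : ℂ) ^ m * (-1 : ℂ) ^ (-m) = 1 := by
    rw [← zpow_add₀ (by norm_num : (-1 : ℂ) ≠ 0), add_neg_cancel, zpow_zero]
  linear_combination
    (-(-1 : ℂ) ^ (m + n + m * n) * cexp ((m * L.η₁ + n * L.η₂) * (z + (m * L.ω₁ + n * L.ω₂) / 2)) *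
      cexp (L.η₂ * (z + (m * L.ω₁ + n * L.ω₂) + L.ω₂ / 2))) * h4

/-- **`σ(z + mω₁ + nω₂) = (-1)^{m+n+mn} e^{(mη₁+nη₂)(z + (mω₁+nω₂)/2)} σ(z)`** for all integers
`m, n` and all `z` (Whittaker–Watson §20.421; from the two generator cases by induction over
`ℤ²`, the two inductions being compatible by Legendre's relation).
[cite: WhittakerWatson1927, §20.421] -/
theorem _root_.PeriodPair.weierstrassSigma_add_lattice (m n : ℤ) (z : ℂ) :
    L.weierstrassSigma (z + (m * L.ω₁ + n * L.ω₂)) = L.sigmaLatticeAut m n z * L.weierstrassSigma z := by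
  have A1 : ∀ w, L.weierstrassSigma (w + L.ω₁) = -cexp (L.η₁ * (w + L.ω₁ / 2)) * L.weierstrassSigma w :=
    L.weierstrassSigma_add_ω₁_holds
  have A2 : ∀ w, L.weierstrassSigma (w + L.ω₂) = -cexp (L.η₂ * (w + L.ω₂ / 2)) * L.weierstrassSigma w :=
    L.weierstrassSigma_add_ω₂_holds
  -- first along `ω₁` (with `n = 0`), then along `ω₂`
  have hm : ∀ (m : ℤ) (z : ℂ),
      L.weierstrassSigma (z + (m * L.ω₁ + (0 : ℤ) * L.ω₂)) = L.sigmaLatticeAut m 0 z * L.weierstrassSigma z := by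
    intro m
    induction m using Int.induction_on with
    | zero => intro z; simp
    | succ k ih =>
      intro z
      have e : z + ((((k : ℤ) + 1 : ℤ) : ℂ) * L.ω₁ + ((0 : ℤ) : ℂ) * L.ω₂) =
          (z + (((k : ℤ) : ℂ) * L.ω₁ + ((0 : ℤ) : ℂ) * L.ω₂)) + L.ω₁ := by
        push_cast; ring
      rw [e, A1, ih z, L.sigmaLatticeAut_succ_left]
      push_cast
      ring
    | pred k ih =>
      intro z
      -- apply the generator law at the point `z + λ_{-k-1,0}`
      have e : (z + ((-(k : ℤ) - 1 : ℤ) * L.ω₁ + (0 : ℤ) * L.ω₂)) + L.ω₁ = z + ((-(k : ℤ) : ℤ) * L.ω₁ + (0 : ℤ) * L.ω₂) := by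
        push_cast; ring
      have h := A1 (z + ((-(k : ℤ) - 1 : ℤ) * L.ω₁ + (0 : ℤ) * L.ω₂))
      rw [e, ih z] at h
      have hs := L.sigmaLatticeAut_succ_left (-(k : ℤ) - 1) 0 z
      rw [show -(k : ℤ) - 1 + 1 = -(k : ℤ) by ring] at hs
      rw [hs] at h
      have hne : -cexp (L.η₁ * (z + ((-(k : ℤ) - 1 : ℤ) * L.ω₁ + (0 : ℤ) * L.ω₂) + L.ω₁ / 2)) ≠ 0 :=
        neg_ne_zero.mpr (Complex.exp_ne_zero _)
      have h' := h
      push_cast at h' hne ⊢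
      exact (mul_left_cancel₀ hne (by linear_combination h')).symm
  induction n using Int.induction_on generalizing z with
  | zero => simpa using hm m z
  | succ k ih =>
    have e : z + ((m : ℂ) * L.ω₁ + ((((k : ℤ) + 1 : ℤ)) : ℂ) * L.ω₂) =
        (z + ((m : ℂ) * L.ω₁ + (((k : ℤ)) : ℂ) * L.ω₂)) + L.ω₂ := by
      push_cast; ring
    rw [e, A2, ih z, L.sigmaLatticeAut_succ_right]
    push_cast
    ring
  | pred k ih =>
    have e : (z + (m * L.ω₁ + (-(k : ℤ) - 1 : ℤ) * L.ω₂)) + L.ω₂ = z + (m * L.ω₁ + (-(k : ℤ) : ℤ) * L.ω₂) := by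
      push_cast; ring
    have h := A2 (z + (m * L.ω₁ + (-(k : ℤ) - 1 : ℤ) * L.ω₂))
    rw [e, ih z] at h
    have hs := L.sigmaLatticeAut_succ_right m (-(k : ℤ) - 1) z
    rw [show -(k : ℤ) - 1 + 1 = -(k : ℤ) by ring] at hs
    rw [hs] at h
    have hne : -cexp (L.η₂ * (z + (m * L.ω₁ + ((-(k : ℤ) - 1 : ℤ)) * L.ω₂) + L.ω₂ / 2)) ≠ 0 :=
      neg_ne_zero.mpr (Complex.exp_ne_zero _)
    have h' := h
    push_cast at h' hne ⊢
    exact (mul_left_cancel₀ hne (by linear_combination h')).symm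

/-- **Modulus of the automorphy factor**: `|σ(z + λ)| = e^{Re(η(λ)(z + λ/2))} |σ(z)|`. [folklore] -/
theorem _root_.PeriodPair.norm_weierstrassSigma_add_lattice (m n : ℤ) (z : ℂ) :
    ‖L.weierstrassSigma (z + (m * L.ω₁ + n * L.ω₂))‖ =
      Real.exp (((m * L.η₁ + n * L.η₂) * (z + (m * L.ω₁ + n * L.ω₂) / 2)).re) *
        ‖L.weierstrassSigma z‖ := by
  rw [L.weierstrassSigma_add_lattice, norm_mul, PeriodPair.sigmaLatticeAut, norm_mul, norm_zpow,
    norm_neg, norm_one, one_zpow, one_mul, Complex.norm_exp]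

end Literature.NumberTheory.Transcendental

end
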